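import Summits.BirchSwinnertonDyer.BirchSwinnertonDyer.Theorems.GoldfeldAllTwistsTwoConverseTwinBirchTamagawa
import HarnessLib

set_option linter.dupNamespace false -- `…BirchSwinnertonDyer.BirchSwinnertonDyer…` is the cell's namespace (D-0017)
set_option autoImplicit false

/-!
# Twin″ (item 19140), the WHOLE additive cell — uniform local arithmetic, I: the global minimal model
# `M_d = [0, −3d, 0, −32d², −64d³]` of `49a1^{(d)}` for EVERY squarefree `d ≢ 1 (mod 4)`

Cell `bsd-goldfeld`, seat `bsd-goldfeld-s1p-c301` (prover, gen 11). Support for item `stmt-BirchSwinnertonDyer-19140`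
(crux twin″ `BSDTwoCMSevenAdditiveRankOne`: Miller's `BSD(W,2)` for every globally minimal CM-by-`ℚ(√−7)` curve `W/ℚ`
with ADDITIVE reduction at `2` and analytic rank `1` — up to `ℚ`-isomorphism and the rational `7`-isogeny these are the
twists `49a1^{(d)}`, `d` squarefree, `d ≢ 1 (mod 4)`). Theses-free; theorems only; no `sorry`. HONEST FRAMING:
arithmetic of an explicit one-parameter family of Weierstrass models; nothing about `L`-values; BSD is not proved by
any of this and no case of twin″ is claimed.

WHY. Seat c301's THEOREM B / B′ files computed the local factors of the BSD quotient on the prime families F1/F2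
(`…TwinBirchLocal*`, `…TwinBirchTamagawa*`: `d = −q`, `−2q`, `q` prime, models `[0, 3q, 0, −32q², 64q³]` /
`[0, 6q, 0, −128q², 512q³]`). The crux is about ALL additive twists, and both of its typed residuals (the Heegner-index
identity of `…TwinHeegnerIndexX049` on the `7`-split half; the genus-point index law `8·m_χ² = #Ш_an·∏ c_p` of memo
INERT7-FORMULA-CENSUS on the `7`-inert half) read the BSD invariants of a GLOBALLY MINIMAL model for COMPOSITE `d`.
This file supplies that model uniformly in `d`:

* `cellModel_baseChange`: `M_d ⊗ ℚ = cm7.quadraticTwist (4d)` (`= 49a1^{(d)}` up to `ℚ`-isomorphism,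
  `exists_smul_eq_cellModel_baseChange`); `c₄ = 1680 d²`, `c₆ = 64·1323·d³`, `Δ = −2¹²·7³·d⁶`;
* **`isGloballyMinimal_cellModel`**: `M_d` is GLOBALLY MINIMAL for every squarefree `d` with `d % 4 ≠ 1` — Kraus at
  `2` (`2⁸ ∤ c₄` as `4 ∤ d`; `c₆/64 + 1 = 1323d³ + 1 ≢ 0 (mod 4)` as `d ≢ 1 (mod 4)`) and `ord_p Δ ≤ 9 < 12` at odd `p`
  (seat c301 gen 8/9 proved the prime cases `d = −q`, `−2q` by the same test);
* `dvd_of_prime_dvd_cellModel_Δ`: the bad primes are among `2`, `7` and the prime factors of `d`.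
The sibling file II (`…TwinAdditiveTamagawaOdd`) computes `c_ℓ(M_d) ∈ {2, 4}` at every odd `ℓ ∣ d`, `ℓ ≠ 7`.
References: [Kraus1989] Prop. 2; [SilvermanAEC2009] VII.1 Rem. 1.1, VIII.8, X.5 Cor. 5.4; [Silverman1994] IV.9.4.
-/

noncomputable section

open scoped Classical NumberField

open WeierstrassCurve IsDedekindDomain IsLocalRing Rat.HeightOneSpectrum
  Literature.NumberTheory.EllipticCurves Literature.NumberTheory.EllipticCurves.ModularForms
  Literature.NumberTheory.QuadraticForms
  Summit.BirchSwinnertonDyer.BirchSwinnertonDyer.Rank2Observatory.Tate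
  Summit.BirchSwinnertonDyer.BirchSwinnertonDyer.Rank2Observatory.RootNumber
  Summit.BirchSwinnertonDyer.BirchSwinnertonDyer.Rank2Observatory.Tam

namespace Summit.BirchSwinnertonDyer.BirchSwinnertonDyer.Theorems.GoldfeldGoodTwists

/-! ## §0 The integer model `M_d = [0, −3d, 0, −32d², −64d³]` of `49a1^{(d)}` and its global minimality -/

section Model

variable (d : ℤ)

/-- `M_d ⊗ ℚ = X₀(49)^{(4d)}` (`b₂(cm7) = −3`, `b₄ = −4`, `b₆ = −4`). [cite: SilvermanAEC2009, X.5 Cor. 5.4] -/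
theorem cellModel_baseChange :
    (⟨0, -3 * d, 0, -32 * d ^ 2, -64 * d ^ 3⟩ : WeierstrassCurve ℤ).baseChange ℚ =
      cm7.quadraticTwist ((4 * d : ℤ) : ℚ) := by
  ext <;> simp [baseChange, quadraticTwist, b₂, b₄, b₆] <;> ring

/-- A model of `49a1^{(d)}` is a model of `M_d ⊗ ℚ = 49a1^{(4d)}` (`⟨2⁻¹, 0, 0, 0⟩ • E^{(d)} = E^{(4d)}`).
[cite: SilvermanAEC2009, X.5 Cor. 5.4] -/
theorem exists_smul_eq_cellModel_baseChange {d : ℤ} (W : WeierstrassCurve ℚ) {C : VariableChange ℚ}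
    (hC : C • W = cm7.quadraticTwist (d : ℚ)) :
    ∃ C' : VariableChange ℚ, C' • W = (⟨0, -3 * d, 0, -32 * d ^ 2, -64 * d ^ 3⟩ : WeierstrassCurve ℤ).baseChange ℚ :=
  ⟨(⟨(Units.mk0 (2 : ℚ) two_ne_zero)⁻¹, 0, 0, 0⟩ : VariableChange ℚ) * C, by
    rw [mul_smul, hC, cellModel_baseChange, show ((4 * d : ℤ) : ℚ) = (2 : ℚ) ^ 2 * (d : ℚ) by push_cast; ring]
    exact (cm7.quadraticTwist_sq_mul two_ne_zero _).symm⟩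

/-- `c₄(M_d) = 1680 d² = 2⁴·105·d²`. [folklore] -/
theorem cellModel_c₄ : (⟨0, -3 * d, 0, -32 * d ^ 2, -64 * d ^ 3⟩ : WeierstrassCurve ℤ).c₄ = 1680 * d ^ 2 := by
  simp [WeierstrassCurve.c₄, b₂, b₄]; ring

/-- `c₆(M_d) = 84672 d³ = 64·(1323 d³)`. [folklore] -/
theorem cellModel_c₆ :
    (⟨0, -3 * d, 0, -32 * d ^ 2, -64 * d ^ 3⟩ : WeierstrassCurve ℤ).c₆ = 64 * (1323 * d ^ 3) := by
  simp [WeierstrassCurve.c₆, b₂, b₄, b₆]; ring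

/-- `Δ(M_d) = −2¹²·7³·d⁶`. [folklore] -/
theorem cellModel_Δ :
    (⟨0, -3 * d, 0, -32 * d ^ 2, -64 * d ^ 3⟩ : WeierstrassCurve ℤ).Δ = -(2 ^ 12 * 7 ^ 3 * d ^ 6) := by
  simp [WeierstrassCurve.Δ, b₂, b₄, b₆, b₈]; ring

variable {d}

/-- A prime dividing `Δ(M_d) = −2¹²7³d⁶` is `2`, `7` or divides `d`. [folklore] -/
theorem dvd_of_prime_dvd_cellModel_Δ {p : ℕ} (hp : p.Prime)
    (h : (p : ℤ) ∣ (⟨0, -3 * d, 0, -32 * d ^ 2, -64 * d ^ 3⟩ : WeierstrassCurve ℤ).Δ) :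
    p = 2 ∨ p = 7 ∨ (p : ℤ) ∣ d := by
  rw [cellModel_Δ, dvd_neg] at h
  have hp' : Prime (p : ℤ) := Int.prime_iff_natAbs_prime.mpr (by simpa using hp)
  rcases hp'.dvd_or_dvd h with h1 | h1
  · rcases hp'.dvd_or_dvd h1 with h2 | h2
    · left
      have h3 : (p : ℤ) ∣ 2 := hp'.dvd_of_dvd_pow h2
      have h4 : p ∣ 2 := by exact_mod_cast h3
      exact (Nat.prime_dvd_prime_iff_eq hp Nat.prime_two).mp h4
    · right; left
      have h3 : (p : ℤ) ∣ 7 := hp'.dvd_of_dvd_pow h2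
      have h4 : p ∣ 7 := by exact_mod_cast h3
      exact (Nat.prime_dvd_prime_iff_eq hp (by norm_num)).mp h4
  · exact Or.inr (Or.inr (hp'.dvd_of_dvd_pow h1))

/-- For squarefree `d`: `4 ∤ d`. [folklore] -/
theorem not_four_dvd_of_squarefree (hsq : Squarefree d) : ¬ (4 : ℤ) ∣ d := fun h4 => by
  have h22 : (2 : ℤ) * 2 ∣ d := by rwa [show (2 : ℤ) * 2 = 4 by norm_num]
  have hu := Int.isUnit_iff.mp (hsq 2 h22)
  omega

/-- **`M_d = [0, −3d, 0, −32d², −64d³]` is a global minimal model of `49a1^{(d)}`** for every squarefree `d` with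
`d ≢ 1 (mod 4)` (the additive cell; also `d ≡ 2, 3 (mod 4)` positive): Kraus at `2` (`2⁸ ∤ 2⁴·105·d²` since `4 ∤ d`;
`c₆/64 + 1 = 1323d³ + 1 ≢ 0 (mod 4)` since `d ≢ 1 (mod 4)`) and `p¹² ∤ 2¹²7³d⁶` for odd `p` (`ord_p ≤ 3 + 6`).
[cite: Kraus1989, Prop. 2] [cite: SilvermanAEC2009, VII.1 Remark 1.1] -/
theorem isGloballyMinimal_cellModel (hsq : Squarefree d) (hd4 : d % 4 ≠ 1) :
    ((⟨0, -3 * d, 0, -32 * d ^ 2, -64 * d ^ 3⟩ : WeierstrassCurve ℤ).baseChange ℚ).IsGloballyMinimal := by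
  have h4 : ¬ (4 : ℤ) ∣ d := not_four_dvd_of_squarefree hsq
  refine isGloballyMinimal_baseChange_int_of_kraus _ (d := 1323 * d ^ 3) ?_ (cellModel_c₆ d) ?_ ?_
  · -- `2⁸ ∤ 1680 d²`
    rw [cellModel_c₄]
    intro h
    -- `2⁸ ∣ 2⁴·105·d²` ⇒ `2⁴ ∣ 105 d²` ⇒ `16 ∣ d²` (105 odd) ⇒ `4 ∣ d`
    have h2 : (16 : ℤ) ∣ 105 * d ^ 2 := by
      have : (2 : ℤ) ^ 8 = 16 * 16 := by norm_num
      rw [this, show (1680 : ℤ) * d ^ 2 = 16 * (105 * d ^ 2) by ring] at h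
      exact (mul_dvd_mul_iff_left (by norm_num)).mp h
    have h3 : (16 : ℤ) ∣ d ^ 2 := by
      have hcop : IsCoprime (16 : ℤ) 105 := by norm_num [Int.isCoprime_iff_gcd_eq_one]
      exact hcop.dvd_of_dvd_mul_left h2
    -- `16 ∣ d²` ⇒ `4 ∣ d`
    apply h4
    have h2p : Prime (2 : ℤ) := Int.prime_two
    have hd2 : (2 : ℤ) ∣ d := h2p.dvd_of_dvd_pow (dvd_trans ⟨8, by norm_num⟩ h3)
    obtain ⟨k, hk⟩ := hd2
    subst hk
    have h5 : (16 : ℤ) ∣ 4 * k ^ 2 := by rw [show (2 * k) ^ 2 = 4 * k ^ 2 by ring] at h3; exact h3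
    have h6 : (4 : ℤ) ∣ k ^ 2 := by
      rw [show (16 : ℤ) = 4 * 4 by norm_num] at h5
      exact (mul_dvd_mul_iff_left (by norm_num)).mp h5
    have hk2 : (2 : ℤ) ∣ k := h2p.dvd_of_dvd_pow (dvd_trans ⟨2, by norm_num⟩ h6)
    obtain ⟨m, hm⟩ := hk2
    exact ⟨m, by rw [hm]; ring⟩
  · -- `4 ∤ 1323 d³ + 1`
    intro h
    norm_num at h
    have hd' : d % 4 = 0 ∨ d % 4 = 2 ∨ d % 4 = 3 := by omega
    have key : (1323 * d ^ 3 + 1) % 4 ≠ 0 := by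
      rcases hd' with h0 | h2 | h3
      · exact absurd (Int.dvd_of_emod_eq_zero h0) h4
      · have : (d ^ 3) % 4 = 0 := by
          rw [show d ^ 3 = d * (d * d) by ring, Int.mul_emod, Int.mul_emod d d, h2]; norm_num
        omega
      · have : (d ^ 3) % 4 = 3 := by
          rw [show d ^ 3 = d * (d * d) by ring, Int.mul_emod, Int.mul_emod d d, h3]; norm_num
        omega
    exact key (Int.emod_eq_zero_of_dvd h)
  · -- odd primes: `p¹² ∤ 2¹²·7³·d⁶`
    intro p hp hp2 h
    rw [cellModel_Δ, dvd_neg] at h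
    have hp' : Prime (p : ℤ) := Int.prime_iff_natAbs_prime.mpr (by simpa using hp)
    -- strip the power of `2`
    have hcop2 : IsCoprime ((p : ℤ) ^ 12) ((2 : ℤ) ^ 12) := by
      apply IsCoprime.pow
      rw [Int.isCoprime_iff_gcd_eq_one, show (2 : ℤ) = ((2 : ℕ) : ℤ) from rfl, Int.gcd_natCast_natCast]
      exact (Nat.coprime_primes hp Nat.prime_two).mpr hp2
    rw [mul_assoc] at h
    have h' : (p : ℤ) ^ 12 ∣ 7 ^ 3 * d ^ 6 := hcop2.dvd_of_dvd_mul_left h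
    -- `p`-adic valuations: `emultiplicity p (7³ d⁶) ≤ 3 + 6 < 12`
    have hfin : FiniteMultiplicity (p : ℤ) (7 ^ 3 * d ^ 6) := by
      apply Int.finiteMultiplicity_iff.mpr
      refine ⟨by exact_mod_cast hp.one_lt.ne', ?_⟩
      have hd0 : d ≠ 0 := hsq.ne_zero
      positivity
    have hle : (12 : ℕ) ≤ multiplicity (p : ℤ) (7 ^ 3 * d ^ 6) := hfin.le_multiplicity_of_pow_dvd h'
    have h7 : multiplicity (p : ℤ) ((7 : ℤ) ^ 3) ≤ 3 := by
      rw [(Int.finiteMultiplicity_iff.mpr ⟨by exact_mod_cast hp.one_lt.ne', by norm_num⟩).multiplicity_pow hp']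
      have : multiplicity (p : ℤ) 7 ≤ 1 := by
        by_cases hp7 : (p : ℤ) ∣ 7
        · have : (p : ℤ) = 7 := by
            have h77 : p ∣ 7 := by exact_mod_cast hp7
            exact_mod_cast (Nat.prime_dvd_prime_iff_eq hp (by norm_num)).mp h77
          rw [this]
          exact (multiplicity_self).le
        · rw [multiplicity_eq_zero.mpr hp7]; exact zero_le_one
      omega
    have h6 : multiplicity (p : ℤ) (d ^ 6) ≤ 6 := by
      rw [(Int.finiteMultiplicity_iff.mpr ⟨by exact_mod_cast hp.one_lt.ne', hsq.ne_zero⟩).multiplicity_pow hp']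
      have : multiplicity (p : ℤ) d ≤ 1 := by
        refine Nat.le_of_lt_succ ((hfin_d hsq hp).multiplicity_lt_iff_not_dvd.mpr ?_)
        intro hdd
        have := hsq (p : ℤ) (by rw [← sq]; exact hdd)
        rw [Int.isUnit_iff] at this
        have h1 := hp.one_lt
        omega
      omega
    have hmul : multiplicity (p : ℤ) (7 ^ 3 * d ^ 6) =
        multiplicity (p : ℤ) ((7 : ℤ) ^ 3) + multiplicity (p : ℤ) (d ^ 6) := multiplicity_mul hp' hfin
    omega
  where
  /-- finiteness of the multiplicity of a prime in a squarefree integer -/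
  hfin_d (hsq : Squarefree d) {p : ℕ} (hp : p.Prime) : FiniteMultiplicity (p : ℤ) d :=
    Int.finiteMultiplicity_iff.mpr ⟨by exact_mod_cast hp.one_lt.ne', hsq.ne_zero⟩

end Model

end Summit.BirchSwinnertonDyer.BirchSwinnertonDyer.Theorems.GoldfeldGoodTwists

end
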